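import Mathlib
import Literature.RepresentationTheory.FiniteGroups.IrreducibleCharacters
import Literature.RepresentationTheory.FiniteGroups.UnitaryWedderburn

/-!
# `LieRankDesigns` (stmt-MatrixMultiplication-7614), line `Sketch`: stub E `stub_centralDegreeBound` — the central degree bound `dim(θ)² · |Z| ≤ |P|`

Crux `Summit.MatrixMultiplication.MatrixMultiplication.Theses.LevelGradedCohnUmans.LieRankDesigns`; skeleton
`Cruxes/LieRankDesigns/Lines/Sketch.lean` (lead prover-line-stmt-MatrixMultiplication-7614-0, 7 registered stubs A–G);
this file proves the registered stub `stub_centralDegreeBound` verbatim (name + signature) and lands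
`--supports stmt-MatrixMultiplication-7614`.

For a finite group `P`, subgroups `H, Z ≤ P` with `[P, Z] ⊆ H`, and an irreducible complex
representation `θ` of `P` on `W` that is trivial on `H`: `dim(W)² · |Z| ≤ |P|` (the classical
`χ(1)² ≤ [P : Z(χ)]`, Isaacs, *Character Theory of Finite Groups*, Cor. 2.30 / Lemma 2.27).
Proof: for `z ∈ Z`, `θ(g z g⁻¹ z⁻¹) = 1` gives `θ(g) θ(z) = θ(z) θ(g)`, so `θ(z)` is a
self-intertwiner of the irreducible `θ`, hence a scalar `c_z` by Schur (Mathlib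
`Representation.IsIrreducible.algebraMap_intertwiningMap_bijective_of_isAlgClosed`), and
`χ(z) χ(z⁻¹) = c_z c_{z⁻¹} d² = d²` (`d = dim W`, `c_z c_{z⁻¹} d = tr θ(1) = d`).  By Weyl's
unitarian trick (`exists_conj_unitary`, tree) `χ(s⁻¹) = conj χ(s)`, so every term of the
orthonormality relation `∑_{s ∈ P} χ(s) χ(s⁻¹) = |P|` (`IsIrrChar.classInner_eq`, tree) is
`|χ(s)|² ≥ 0`; keeping only the terms `s ∈ Z` gives `|Z| d² ≤ |P|`.
-/

set_option linter.dupNamespace false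

noncomputable section

open scoped BigOperators Matrix
open Literature.RepresentationTheory.FiniteGroups

namespace Summit.MatrixMultiplication.MatrixMultiplication.Theorems.LieRankDesigns

/-- **`tr ρ(s⁻¹) = conj tr ρ(s)`** for a complex matrix representation of a finite group (Serre,
*Linear Representations*, §2.1 Prop. 1 (iii)).  By Weyl's unitarian trick
(`exists_conj_unitary`): `U = u ρ(s) u⁻¹` with `Uᴴ U = 1`, so `u ρ(s⁻¹) u⁻¹ = U⁻¹ = Uᴴ` and
`tr ρ(s⁻¹) = tr Uᴴ = conj tr U = conj tr ρ(s)` (same argument as the tree's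
`Matrix.trace_map_inv_eq_star_trace` in `ArtinLFunctionsBrauerDualProofs`). [folklore] -/
theorem trace_map_inv_eq_star {n : Type} [Fintype n] [DecidableEq n] {P : Type} [Group P]
    [Finite P] (ρ : P →* Matrix n n ℂ) (s : P) : (ρ s⁻¹).trace = star (ρ s).trace := by
  obtain ⟨u, hu⟩ := exists_conj_unitary ρ
  -- `U g = u ρ(g) u⁻¹` is unitary
  set U : P → Matrix n n ℂ := fun g =>
    (u : Matrix n n ℂ) * ρ g * ((u⁻¹ : (Matrix n n ℂ)ˣ) : Matrix n n ℂ) with hU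
  have htr : ∀ g, (ρ g).trace = (U g).trace := fun g => by
    simp only [hU, Matrix.trace_units_conj]
  have hUU : U s⁻¹ * U s = 1 := by
    simp only [hU]
    calc (u : Matrix n n ℂ) * ρ s⁻¹ * ((u⁻¹ : (Matrix n n ℂ)ˣ) : Matrix n n ℂ) *
          ((u : Matrix n n ℂ) * ρ s * ((u⁻¹ : (Matrix n n ℂ)ˣ) : Matrix n n ℂ))
        = (u : Matrix n n ℂ) *
            (ρ s⁻¹ * (((u⁻¹ : (Matrix n n ℂ)ˣ) : Matrix n n ℂ) * (u : Matrix n n ℂ)) * ρ s) *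
            ((u⁻¹ : (Matrix n n ℂ)ˣ) : Matrix n n ℂ) := by
          simp only [Matrix.mul_assoc]
      _ = 1 := by
          rw [Units.inv_mul, Matrix.mul_one, ← map_mul, inv_mul_cancel, map_one, Matrix.mul_one,
            Units.mul_inv]
  have hUinv : U s⁻¹ = (U s)ᴴ := by
    have h1 : U s * (U s)ᴴ = 1 := mul_eq_one_comm.1 (hu s)
    calc U s⁻¹ = U s⁻¹ * (U s * (U s)ᴴ) := by rw [h1, Matrix.mul_one]
      _ = (U s)ᴴ := by rw [← Matrix.mul_assoc, hUU, Matrix.one_mul]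
  rw [htr, htr, hUinv, Matrix.trace_conjTranspose]

/-- **`χ(s⁻¹) = conj χ(s)`** for the character of a finite-dimensional complex representation of
a finite group (Serre, *Linear Representations*, §2.1 Prop. 1 (iii)): pass to the matrix form in
a basis (`LinearMap.toMatrix`, `LinearMap.trace_eq_matrix_trace`) and use
`trace_map_inv_eq_star`. [folklore] -/
theorem character_inv_eq_star {P : Type} [Group P] [Finite P] {W : Type} [AddCommGroup W]
    [Module ℂ W] [FiniteDimensional ℂ W] (θ : Representation ℂ P W) (s : P) :
    θ.character s⁻¹ = star (θ.character s) := by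
  classical
  let b := Module.finBasis ℂ W
  -- the matrix form of `θ` in the basis `b`
  let ρ : P →* Matrix (Fin (Module.finrank ℂ W)) (Fin (Module.finrank ℂ W)) ℂ :=
    { toFun := fun g => LinearMap.toMatrix b b (θ g)
      map_one' := by simp only [map_one, LinearMap.toMatrix_one]
      map_mul' := fun g h => by simp only [map_mul, LinearMap.toMatrix_mul] }
  have hρ : ∀ g, θ.character g = (ρ g).trace := fun g =>
    LinearMap.trace_eq_matrix_trace ℂ b (θ g)
  rw [hρ, hρ, trace_map_inv_eq_star]

/-- `χ(s) χ(s⁻¹) = |χ(s)|²` (as a complex number). [folklore] -/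
theorem character_mul_character_inv {P : Type} [Group P] [Finite P] {W : Type} [AddCommGroup W]
    [Module ℂ W] [FiniteDimensional ℂ W] (θ : Representation ℂ P W) (s : P) :
    θ.character s * θ.character s⁻¹ = (Complex.normSq (θ.character s) : ℂ) := by
  rw [character_inv_eq_star, Complex.star_def, Complex.mul_conj]

/-- **Schur's lemma for a commuting operator**: if `θ` is irreducible (finite-dimensional, over
`ℂ`) and `θ z` commutes with every `θ g`, then `θ z` is a homothety (Mathlib
`Representation.IsIrreducible.algebraMap_intertwiningMap_bijective_of_isAlgClosed` applied to
the self-intertwiner `θ z`). [folklore] -/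
theorem exists_apply_eq_smul_one {P W : Type} [Group P] [AddCommGroup W] [Module ℂ W]
    [FiniteDimensional ℂ W] (θ : Representation ℂ P W) [θ.IsIrreducible] {z : P}
    (hz : ∀ g : P, θ g * θ z = θ z * θ g) :
    ∃ c : ℂ, θ z = c • (1 : W →ₗ[ℂ] W) := by
  let f : θ.IntertwiningMap θ :=
    LinearMap.intertwiningMap_of_isIntertwiningMap θ θ (θ z) fun g v => by
      rw [← Module.End.mul_apply, ← hz g, Module.End.mul_apply]
  obtain ⟨c, hc⟩ :=
    (Representation.IsIrreducible.algebraMap_intertwiningMap_bijective_of_isAlgClosed (ρ := θ)).2 f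
  refine ⟨c, ?_⟩
  have := congrArg Representation.IntertwiningMap.toLinearMap hc
  rw [Representation.IntertwiningMap.algebraMap_apply,
    Representation.IntertwiningMap.toLinearMap_smul] at this
  exact this.symm

/-- **`dim(θ)² · |Z| ≤ |P|` for an `H`-trivial irreducible `θ` of `P` when `[P, Z] ⊆ H`**
(registered stub E of line `Sketch`, statement `CentralDegreeBound`; Isaacs, *Character Theory*,
Cor. 2.30: `χ(1)² ≤ [P : Z(χ)]`).  The elements of `Z` act by scalars (Schur), so
`χ(z) χ(z⁻¹) = d²` on `Z`, and `|P| = ∑_{s ∈ P} |χ(s)|² ≥ ∑_{z ∈ Z} |χ(z)|² = |Z| d²`. -/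
theorem stub_centralDegreeBound :
    ∀ (P : Type) [Group P] [Fintype P] (H Z : Subgroup P),
      (∀ g : P, ∀ z ∈ Z, g * z * g⁻¹ * z⁻¹ ∈ H) →
      ∀ (W : Type) [AddCommGroup W] [Module ℂ W] [FiniteDimensional ℂ W] (θ : Representation ℂ P W),
        θ.IsIrreducible → (∀ h ∈ H, θ h = LinearMap.id) →
          Module.finrank ℂ W ^ 2 * Nat.card Z ≤ Nat.card P := by
  intro P _ _ H Z hcomm W _ _ _ θ hirr hH
  classical
  haveI : θ.IsIrreducible := hirr
  set χ : P → ℂ := θ.character with hχ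
  set d : ℕ := Module.finrank ℂ W with hd
  -- (1) `θ g` commutes with `θ z` for `z ∈ Z`, since `θ (g z g⁻¹ z⁻¹) = 1`
  have hcommθ : ∀ z ∈ Z, ∀ g : P, θ g * θ z = θ z * θ g := by
    intro z hz g
    have h1 : θ (g * z * g⁻¹ * z⁻¹) = 1 := (hH _ (hcomm g z hz)).trans Module.End.one_eq_id.symm
    calc θ g * θ z = θ (g * z) := (map_mul θ g z).symm
      _ = θ (g * z * g⁻¹ * z⁻¹ * (z * g)) := by congr 1; group
      _ = θ z * θ g := by rw [map_mul θ (g * z * g⁻¹ * z⁻¹) (z * g), h1, one_mul, map_mul]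
  -- (2)+(3) Schur: on `Z`, `θ z = c_z • 1` and `χ(z) χ(z⁻¹) = d²`
  have hZval : ∀ z ∈ Z, χ z * χ z⁻¹ = (d : ℂ) * d := by
    intro z hz
    obtain ⟨c, hc⟩ := exists_apply_eq_smul_one θ (hcommθ z hz)
    obtain ⟨c', hc'⟩ := exists_apply_eq_smul_one θ (hcommθ z⁻¹ (Z.inv_mem hz))
    have hone : (c * c') • (1 : W →ₗ[ℂ] W) = 1 :=
      calc (c * c') • (1 : W →ₗ[ℂ] W) = (c • (1 : W →ₗ[ℂ] W)) * (c' • (1 : W →ₗ[ℂ] W)) := by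
            rw [smul_mul_smul_comm, mul_one]
        _ = θ z * θ z⁻¹ := by rw [hc, hc']
        _ = 1 := by rw [← map_mul, mul_inv_cancel, map_one]
    have hcc : c * c' * d = (d : ℂ) := by
      have h := congrArg (LinearMap.trace ℂ W) hone
      rwa [map_smul, LinearMap.trace_one, smul_eq_mul] at h
    have hχz : χ z = c * d := by
      rw [hχ, Representation.character, hc, map_smul, LinearMap.trace_one, smul_eq_mul]
    have hχz' : χ z⁻¹ = c' * d := by
      rw [hχ, Representation.character, hc', map_smul, LinearMap.trace_one, smul_eq_mul]
    calc χ z * χ z⁻¹ = c * d * (c' * d) := by rw [hχz, hχz']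
      _ = c * c' * d * d := by ring
      _ = d * d := by rw [hcc]
  -- (4) orthonormality `∑_s χ(s) χ(s⁻¹) = |P|`
  have hirrχ : IsIrrChar P χ := ⟨W, _, _, inferInstance, θ, hirr, rfl⟩
  have hsum : ∑ s : P, χ s * χ s⁻¹ = (Fintype.card P : ℂ) := by
    have h := hirrχ.classInner_eq hirrχ
    rw [if_pos rfl, classInner_apply,
      inv_mul_eq_one₀ (Nat.cast_ne_zero.2 Fintype.card_ne_zero)] at h
    exact h.symm
  -- (5) real parts: every term is `|χ(s)|² ≥ 0`, the terms on `Z` are `d²`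
  have hre : ∀ s : P, (χ s * χ s⁻¹).re = Complex.normSq (χ s) := fun s => by
    rw [hχ, character_mul_character_inv, Complex.ofReal_re]
  have hreal : (Fintype.card P : ℝ) = ∑ s : P, (χ s * χ s⁻¹).re := by
    have h := congrArg Complex.re hsum
    rw [Complex.re_sum, Complex.natCast_re] at h
    exact h.symm
  have hlower : ∑ s : P, (if s ∈ Z then ((d : ℝ) * d) else 0) ≤ ∑ s : P, (χ s * χ s⁻¹).re := by
    refine Finset.sum_le_sum fun s _ => ?_
    split_ifs with hs
    · have h := congrArg Complex.re (hZval s hs)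
      have h2 : ((d : ℂ) * d).re = (d : ℝ) * d := by norm_cast
      rw [h, h2]
    · rw [hre]; exact Complex.normSq_nonneg _
  have hcount : ∑ s : P, (if s ∈ Z then ((d : ℝ) * d) else 0) = (Nat.card Z : ℝ) * (d * d) := by
    rw [Finset.sum_ite, Finset.sum_const_zero, add_zero, Finset.sum_const, nsmul_eq_mul,
      Nat.card_eq_fintype_card, Fintype.card_subtype]
  have hfin : ((d ^ 2 * Nat.card Z : ℕ) : ℝ) ≤ (Nat.card P : ℝ) := by
    rw [Nat.card_eq_fintype_card (α := P), hreal]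
    refine le_trans (le_of_eq ?_) hlower
    rw [hcount]; push_cast; ring
  exact_mod_cast hfin

end Summit.MatrixMultiplication.MatrixMultiplication.Theorems.LieRankDesigns

end
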